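import Summits.QuantumFields.BalabanUV.T4Continuum.Support.NE3GaugedTwoTierShape
import Summits.QuantumFields.BalabanUV.T4Continuum.Support.NE3LocalSupMajorantWitness
import Summits.QuantumFields.BalabanUV.T4Continuum.Support.MinimalActionWitness
import HarnessLib

/-!
# T⁴ programme, node NE3, route Π — (Π-REG-γ″)-NV: THE GAUGED TWO-TIER MAJORANT `GaugedTwoTier` IS INHABITED — at `λ = 0` by the smooth witnesses
# (`C = 1`, `C = √d`), and by a GENUINE TWO-TIER datum: a bulk re-gauged by a corner-spike potential of relative height `σ·L^k`, with k-FREE `C = 1 + σ`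

NE3 formalisation swarm `b2b-balaban-t4-ne3-formalise-*`, LEAF PROVER 03 (gen 12).  Asked for by the Π-C-3γ″ holder (leaf-02-g8, HOME/CLAIMS.log l.24833
«→ leaf-03∕04: NV of (Π-REG-γ′) at smooth data»; ACK l.24928; leaf-04-g8 «yours» l.24945; binder = leaf-02-g8's `NE3GaugedTwoTierShape` (§4 «Γ″» of
D-ne3leaf02g8-1, journal l.25003), consumed BY NAME: `GaugedTwoTierData` ∕ `GaugedTwoTier`).  Sibling of this lineage's NV files for the retired sup-currency
shapes (`NE3LocalSupMajorantWitness` p243451, `…BallWitness`), whose helper lemmas (`sum_periodBox_const`, `dirSq_of_norm_eq`, `norm_onePol`, `dirSq_onePol`)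
are re-used by name.

CONTENT (all [folklore]; 0 sorry; 0 def):
§1 `λ = 0` (the companion is the field itself, at EVERY background `W`, profile and corner sets): `gaugeAct_expGauge_zero` (`(V)^{e^0} = V`),
   `gaugedTwoTierData_of_lam_zero`, the principle `gaugedTwoTier_of_sup_of_mass` (global sup `r ≤ 1∕8192` + ONE mass inequality), **`gaugedTwoTier_const`**
   (constant skew field, `m ≡ ‖A‖`, `ℓ = Λ = 0`, `C = 1`), **`gaugedTwoTier_onePol`** (one polarisation, `C = √d`).
§2 **A GENUINE TWO-TIER WITNESS** at `W = flatCfg` (two distinct diagonal slots `i₁ ≠ i₂` of `n`, all data diagonal with imaginary entries, hence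
   commuting, so the gauge relation (E) `W·e^{X₀} = (W·e^{B})^{e^{λ}}` holds EXACTLY): `gaugedTwoTier_of_diagonalGauge` (any real potential `t`,
   `0 ≤ t ≤ Λ₀ ≤ 1∕8192`, periodic, box-dominated by `Λ·Σ_{c∈S} prof(y − c)`; bulk `B ≡ r·i·E_{i₂i₂}`; field `X₀(y,μ) = diag((t y − t(y+e_μ))·i·δ_{i₁} + r·i·δ_{i₂})`,
   whose norm is `≥ r` on EVERY bond — the bulk slot carries the ℓ² mass) and **`gaugedTwoTier_cornerSpike`**: for ANY profile `0 ≤ prof ≤ 1`, `r ≤ 1∕8192`,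
   `σ ≥ 0`, `σ·L^k·r ≤ 1∕8192`, the potential `t(y) = σ·L^k·r·prof(y − ⌊y∕L^k⌋L^k)` (the profile re-rooted at each block's lower corner — `N·L^k`-periodic for
   every `prof`, and on the box of record of `(z,κ)` the root is `L^k•z` or `L^k•(z+e_κ)`: `blockCorner_mem_pair`) yields
   `GaugedTwoTier L N k flatCfg X₀ prof S (m ≡ r) (ℓ ≡ 0) (Λ ≡ σ·L^k·r) (1 + σ)` with `S z κ = {L^k•z, L^k•(z+e_κ)}` — **`C = 1 + σ` does not depend on `k`**,
   although for the corner-indicator profile `X₀` has spikes of height `σ·L^k·r` on the `2d` bonds at every block corner (relative height `σ·L^k` over its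
   bulk): the configuration that forced `(L^k)^d ≤ C²` on the retired sup-currency shape (`NE3LocalSupMajorantWitness.sq_le_of_oneBond`) — NE3-R2 g12's
   D-ne3r2-g12-1 moral («the corner spike is a gauge artefact; the right currency does not see it») on a synthetic field, in the kernel.
   Kit: `blockCorner_periodic`, `diagonal_mem_skewAdjoint`, `star_ofReal_mul_I`, `star_single_ofReal_mul_I`,
   `star_twoSlot`, `norm_diagonal_single`, `abs_le_norm_twoSlot`, `exp_add_add_neg_of_commute`, `diagonal_twoSlot_eq`.

HONEST FRAMING.  NON-VACUITY of OUR hypothesis shape (Π-REG-γ″) at synthetic data (constant ∕ one-polarisation fields; a diagonal two-tier datum at the FLAT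
background); it says NOTHING about the relative field of a minimiser pair — that the pair admits gauged two-tier data with k-free `C` is B11 Thm 1 ∕ Prop 2
regularity TYPE in the unpinned Landau gauge plus the Coulomb structure of the pinning (leaf-02-g8's leaf, NE3-R2 g12's engine evidence D-12-4), a typed leaf
asserted for nothing; Π-C-3γ″, `DecomposedRep`'s sizes, (P♮)_W numerics, (H∃), T-E_w♯ and NE3 are NOT proved; spine PROVED 0∕9; finite T⁴ rung (B)+1 — NOT
infinite volume, NOT mass gap, NOT BetaPertH, NOT Clay.  ABSOLUTE RULE kept (no printed sentence is a hypothesis).  PLACEMENT: `Summits/QuantumFields/BalabanUV/`.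
HONEST DEPENDENCY: continuum YM on T⁴ ⇐ BetaPertH ∧ nine spine estimates (0/9 proved); BetaPertH ⇐ (D1) ∧ (D4) ∧ CAP+tail; G-an2-4 gates asym, D1 and NE2/3/4.
-/

set_option autoImplicit false

namespace Summit.QuantumFields.BalabanUV.T4Continuum.NE3GaugedTwoTierWitness

open scoped BigOperators Matrix.Norms.L2Operator
open NormedSpace Finset Matrix
open Literature.MathematicalPhysics.QuantumFieldTheory.Balaban1983to89
open B7Prop1Explicit B7Prop2Explicit MatrixLog
open B7Prop1Local (InBox loK bondHiK)
open T4AveragingDeficitWall (IsSkewDir vary dirSq)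
open T4AveragingDeficitWallBoundary (periodBox card_periodBox mem_periodBox norm_real_mul_I)
open AveragingDeficitPeriodicCounting (IsPeriodicDir)
open BlockAveragePushDirGauge (gaugeDir expGauge gaugeAct_const_one)
open MinimalActionWitness (flatCfg)
open NE3LocalSupMajorantWitness (sum_periodBox_const dirSq_of_norm_eq norm_onePol dirSq_onePol)
open NE3GaugedTwoTierShape (GaugedTwoTierData GaugedTwoTier)

noncomputable section

variable {d : ℕ} {n : Type*} [Fintype n] [DecidableEq n]

/-! ## §1 Gauge data with `λ = 0`: the companion is the field itself -/

/-- With zero charges the gauge relation is the identity: `(W·e^{B})^{e^{0}} = W·e^{B}`. [folklore] -/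
theorem gaugeAct_expGauge_zero (V : Site d → Fin d → (Matrix n n ℂ)ˣ) :
    gaugeAct (expGauge (fun _ : Site d => (0 : Matrix n n ℂ)) 1) V = V := by
  have hu : expGauge (fun _ : Site d => (0 : Matrix n n ℂ)) 1 = fun _ => 1 := by
    funext x; simp [expGauge]
  rw [hu, gaugeAct_const_one]

/-- **`λ = 0` GAUGE DATA**: a skew, `N·L^k`-periodic field `X₀` in the BCH ball with a GLOBAL sup bound `‖X₀‖ ≤ r` carries the clauses of
(Π-REG-γ″) with companion `B = X₀`, charges `λ = 0`, tiers `m ≡ r`, `ℓ = Λ = 0`, at EVERY background `W`, profile `prof` and corner sets `S`.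
[folklore] -/
theorem gaugedTwoTierData_of_lam_zero [Nonempty n] {L N k : ℕ} (W : Site d → Fin d → (Matrix n n ℂ)ˣ)
    {X₀ : Site d → Fin d → Matrix n n ℂ} (hXs : IsSkewDir X₀) (hXP : IsPeriodicDir X₀ ((L ^ k * N : ℕ) : ℤ))
    {r : ℝ} (hX : ∀ (y : Site d) (μ : Fin d), ‖X₀ y μ‖ ≤ r) (hr : r ≤ 1 / 8192) (prof : Site d → ℝ) (S : Site d → Fin d → Finset (Site d)) :
    GaugedTwoTierData L N k W X₀ prof S (fun _ => 0) X₀ (fun _ _ => r) (fun _ _ => 0) (fun _ _ => 0) where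
  lam_skew _ := (skewAdjoint _).zero_mem
  lam_per _ _ := rfl
  lam_small _ := by rw [norm_zero]; norm_num
  B_skew := hXs
  B_per := hXP
  B_small y μ := (hX y μ).trans hr
  gauge_eq := (gaugeAct_expGauge_zero _).symm
  dom_B _ _ y μ _ _ := hX y μ
  dom_lam _ _ _ _ := by rw [norm_zero, zero_mul, add_zero]

/-- **THE PRINCIPLE AT `λ = 0`**: a skew periodic small field with a global sup bound `r ≥ 0` and ONE mass inequality
`(L^k)^d·N^d·d·r² ≤ C²·dirSq X₀ (periodBox (N·L^k))` satisfies (Π-REG-γ″) with `m ≡ r`, `ℓ = Λ = 0`, empty corner sets, any profile. [folklore] -/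
theorem gaugedTwoTier_of_sup_of_mass [Nonempty n] {L N k : ℕ} (W : Site d → Fin d → (Matrix n n ℂ)ˣ)
    {X₀ : Site d → Fin d → Matrix n n ℂ} (hXs : IsSkewDir X₀) (hXP : IsPeriodicDir X₀ ((L ^ k * N : ℕ) : ℤ))
    {r C : ℝ} (hr0 : 0 ≤ r) (hX : ∀ (y : Site d) (μ : Fin d), ‖X₀ y μ‖ ≤ r) (hr : r ≤ 1 / 8192) (hC : 0 ≤ C)
    (hmass : ((L : ℝ) ^ k) ^ d * ((N : ℝ) ^ d * ((d : ℝ) * r ^ 2)) ≤ C ^ 2 * dirSq X₀ (periodBox (d := d) (N * L ^ k)))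
    (prof : Site d → ℝ) :
    GaugedTwoTier L N k W X₀ prof (fun _ _ => ∅) (fun _ _ => r) (fun _ _ => 0) (fun _ _ => 0) C := by
  refine ⟨fun _ _ => hr0, fun _ _ => le_rfl, fun _ _ => le_rfl, fun _ _ => by simp, hC,
    ⟨_, _, gaugedTwoTierData_of_lam_zero W hXs hXP hX hr prof _⟩, ?_⟩
  have e1 : ∑ z ∈ periodBox (d := d) N, ∑ κ : Fin d, (r ^ 2 + (0 : ℝ) ^ 2 + (0 / (L : ℝ) ^ k) ^ 2)
      = ∑ _z ∈ periodBox (d := d) N, ∑ _κ : Fin d, r ^ 2 := by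
    refine Finset.sum_congr rfl fun z _ => Finset.sum_congr rfl fun κ _ => ?_
    simp
  rw [e1, sum_periodBox_const]
  exact hmass

/-- **THE CONSTANT SKEW FIELD** `X₀ ≡ A` (`A` skew, `‖A‖ ≤ 1∕8192`): (Π-REG-γ″) with `m ≡ ‖A‖`, `ℓ = Λ = 0`, **`C = 1`**, at every `W`, `L`, `N`, `k`,
profile and with empty corner sets. [folklore] -/
theorem gaugedTwoTier_const [Nonempty n] (L N k : ℕ) (W : Site d → Fin d → (Matrix n n ℂ)ˣ) {A : Matrix n n ℂ}
    (hA : A ∈ skewAdjoint (Matrix n n ℂ)) (hAs : ‖A‖ ≤ 1 / 8192) (prof : Site d → ℝ) :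
    GaugedTwoTier L N k W (fun (_ : Site d) (_ : Fin d) => A) prof (fun _ _ => ∅) (fun _ _ => ‖A‖) (fun _ _ => 0) (fun _ _ => 0) 1 := by
  refine gaugedTwoTier_of_sup_of_mass W (fun _ _ => hA) (fun _ _ _ => rfl) (norm_nonneg A) (fun _ _ => le_rfl) hAs zero_le_one
    (le_of_eq ?_) prof
  have e1 : dirSq (fun (_ : Site d) (_ : Fin d) => A) (periodBox (d := d) (N * L ^ k)) = (((N * L ^ k) ^ d : ℕ) : ℝ) * ((d : ℝ) * ‖A‖ ^ 2) := by
    rw [dirSq_of_norm_eq (fun _ _ => rfl), card_periodBox]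
  rw [e1]; push_cast; ring

/-- **ONE POLARISATION** `X₀ = A` on the `μ₀`-bonds and `0` elsewhere (`A` skew, small): (Π-REG-γ″) with `m ≡ ‖A‖`, `ℓ = Λ = 0`, **`C = √d`**. [folklore] -/
theorem gaugedTwoTier_onePol [Nonempty n] (L N k : ℕ) (W : Site d → Fin d → (Matrix n n ℂ)ˣ) (μ₀ : Fin d) {A : Matrix n n ℂ}
    (hA : A ∈ skewAdjoint (Matrix n n ℂ)) (hAs : ‖A‖ ≤ 1 / 8192) (prof : Site d → ℝ) :
    GaugedTwoTier L N k W (fun (_ : Site d) (μ : Fin d) => if μ = μ₀ then A else (0 : Matrix n n ℂ)) prof (fun _ _ => ∅)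
      (fun _ _ => ‖A‖) (fun _ _ => 0) (fun _ _ => 0) (Real.sqrt d) := by
  refine gaugedTwoTier_of_sup_of_mass W (fun _ μ => ?_) (fun _ _ _ => rfl) (norm_nonneg A) (fun _ μ => ?_) hAs (Real.sqrt_nonneg _)
    (le_of_eq ?_) prof
  · show (if μ = μ₀ then A else (0 : Matrix n n ℂ)) ∈ skewAdjoint (Matrix n n ℂ)
    split_ifs
    · exact hA
    · exact (skewAdjoint _).zero_mem
  · rw [norm_onePol μ₀ A μ]; split_ifs
    · exact le_rfl
    · exact norm_nonneg A
  · have e1 : dirSq (fun (_ : Site d) (μ : Fin d) => if μ = μ₀ then A else (0 : Matrix n n ℂ)) (periodBox (d := d) (N * L ^ k))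
        = (((N * L ^ k) ^ d : ℕ) : ℝ) * ‖A‖ ^ 2 := by rw [dirSq_onePol, card_periodBox]
    rw [e1, Real.sq_sqrt (Nat.cast_nonneg d)]; push_cast; ring

/-! ## §2 A GENUINE TWO-TIER WITNESS: a bulk of size `r` re-gauged by a corner-spike potential of amplitude `σ·L^k·r` — k-FREE `C = 1 + σ`

All data are DIAGONAL matrices with purely imaginary entries on two distinct diagonal slots `i₁ ≠ i₂` (so everything commutes and the gauge relation
holds EXACTLY): companion `B ≡ r·i·E_{i₂i₂}`, charges `λ(y) = t(y)·i·E_{i₁i₁}` with `t(y) = σ·L^k·r·prof(y − corner of y's block)` for ANY profile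
`0 ≤ prof ≤ 1`, and `X₀(y,μ) := λ(y) + B − λ(y+e_μ)`.  Then `‖X₀(y,μ)‖ = max(|t(y) − t(y+e_μ)|, r) ≥ r` bondwise, so the BULK carries the ℓ² mass,
while the spike tier enters (T3) with the weight `(Λ∕L^k)² = (σr)²`: `C² = 1 + σ²` serves, whatever `k`.  For the corner-indicator profile the field
has spikes of height `σ·L^k·r` on the `2d` bonds at every block corner — relative height `σ·L^k` over the bulk — the configuration that forced
`(L^k)^d ≤ C²` on the old sup-currency shape (`NE3LocalSupMajorantWitness.sq_le_of_oneBond`). -/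

section spike

/-- The lower block corner `⌊y∕M⌋·M` shifts with the period: corner(y + (M·P)e_i) = corner(y) + (M·P)e_i. [folklore] -/
theorem blockCorner_periodic (M : ℤ) (hM : M ≠ 0) (P : ℤ) (y : Site d) (i : Fin d) :
    (fun j => M * ((y + (M * P) • e i) j / M)) = (fun j => M * (y j / M)) + (M * P) • e i := by
  funext j
  simp only [Pi.add_apply, Pi.smul_apply, smul_eq_mul, e, Pi.single_apply]
  split_ifs with h
  · rw [mul_one, show y j + M * P = y j + P * M by ring, Int.add_mul_ediv_right _ _ hM]
    all_goals ring
  · simp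

/-- In the box of record of the coarse bond `(z, κ)` the block corner of a site is `L^k•z` or `L^k•(z + e_κ)`. [folklore] -/
theorem blockCorner_mem_pair {L : ℕ} (hL : 1 ≤ L) (k : ℕ) (z : Site d) (κ : Fin d) {y : Site d}
    (hy : InBox (loK L k z) (bondHiK L k z κ) y) :
    (fun j => ((L : ℤ) ^ k) * (y j / (L : ℤ) ^ k)) ∈ ({loK L k z, loK L k (z + e κ)} : Finset (Site d)) := by
  have hM : (0 : ℤ) < (L : ℤ) ^ k := by positivity
  -- coordinatewise quotient: `z j`, or `z κ + 1` in the `κ`-th coordinate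
  have hq : ∀ j, y j / (L : ℤ) ^ k = z j ∨ (j = κ ∧ y j / (L : ℤ) ^ k = z j + 1) := by
    intro j
    obtain ⟨h1, h2⟩ := hy j
    simp only [loK, bondHiK] at h1 h2
    have hlo : z j ≤ y j / (L : ℤ) ^ k := by
      rw [Int.le_ediv_iff_mul_le hM]; linarith
    by_cases hj : j = κ
    · subst hj
      rw [if_pos rfl] at h2
      have hhi : y j / (L : ℤ) ^ k < z j + 2 := by
        rw [Int.ediv_lt_iff_lt_mul hM]; linarith
      generalize y j / (L : ℤ) ^ k = q at hlo hhi ⊢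
      rcases (show q = z j ∨ q = z j + 1 by omega) with h | h
      · exact Or.inl h
      · exact Or.inr ⟨rfl, h⟩
    · rw [if_neg hj, add_zero] at h2
      have hhi : y j / (L : ℤ) ^ k < z j + 1 := by
        rw [Int.ediv_lt_iff_lt_mul hM]; linarith
      generalize y j / (L : ℤ) ^ k = q at hlo hhi ⊢
      exact Or.inl (by omega)
  rw [Finset.mem_insert, Finset.mem_singleton]
  by_cases hκ : y κ / (L : ℤ) ^ k = z κ
  · left
    funext j
    simp only [loK]
    rcases hq j with h | ⟨hj, h⟩
    · rw [h]
    · subst hj; rw [hκ]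
  · right
    funext j
    simp only [loK, Pi.add_apply, e, Pi.single_apply]
    rcases hq j with h | ⟨hj, h⟩
    · by_cases hj : j = κ
      · subst hj; exact absurd h hκ
      · rw [h, if_neg hj, add_zero]
    · subst hj; rw [h, if_pos rfl]

omit [Fintype n] in
/-- A diagonal matrix with `star`-anti-invariant entries is skew. [folklore] -/
theorem diagonal_mem_skewAdjoint {w : n → ℂ} (hw : ∀ j, star (w j) = -w j) : diagonal w ∈ skewAdjoint (Matrix n n ℂ) := by
  rw [skewAdjoint.mem_iff, star_eq_conjTranspose, diagonal_conjTranspose, diagonal_neg]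
  congr 1; funext j; exact hw j

omit [Fintype n] [DecidableEq n] in
/-- `star (t·i) = −t·i` for real `t`. [folklore] -/
theorem star_ofReal_mul_I (t : ℝ) : star ((t : ℂ) * Complex.I) = -((t : ℂ) * Complex.I) := by
  rw [Complex.star_def, map_mul, Complex.conj_ofReal, Complex.conj_I]; ring

omit [Fintype n] in
/-- The imaginary single-slot vector `c·i·δ_{j₀}` is `star`-anti-invariant entrywise. [folklore] -/
theorem star_single_ofReal_mul_I (j₀ : n) (c : ℝ) (j : n) :
    star ((Pi.single j₀ (((c : ℂ)) * Complex.I) : n → ℂ) j) = -((Pi.single j₀ (((c : ℂ)) * Complex.I) : n → ℂ) j) := by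
  by_cases h : j = j₀
  · subst h; rw [Pi.single_eq_same]; exact star_ofReal_mul_I c
  · rw [Pi.single_eq_of_ne h]; simp

omit [Fintype n] in
/-- The two-slot imaginary vector is `star`-anti-invariant entrywise. [folklore] -/
theorem star_twoSlot (i₁ i₂ : n) (a b : ℝ) (j : n) :
    star ((Pi.single i₁ (((a : ℂ)) * Complex.I) + Pi.single i₂ (((b : ℂ)) * Complex.I) : n → ℂ) j)
      = -((Pi.single i₁ (((a : ℂ)) * Complex.I) + Pi.single i₂ (((b : ℂ)) * Complex.I) : n → ℂ) j) := by
  rw [Pi.add_apply, star_add, star_single_ofReal_mul_I, star_single_ofReal_mul_I, neg_add]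

/-- Operator norm of the single-slot diagonal matrix: `‖diag(c·i·δ_{j₀})‖ = |c|`. [folklore] -/
theorem norm_diagonal_single (j₀ : n) (c : ℝ) : ‖(diagonal (Pi.single j₀ (((c : ℂ)) * Complex.I)) : Matrix n n ℂ)‖ = |c| := by
  rw [l2_opNorm_diagonal, Pi.norm_single, norm_real_mul_I]

/-- Operator norm of the two-slot diagonal matrix from below: `≥ |b|` (the `i₂` slot; `i₁ ≠ i₂`). [folklore] -/
theorem abs_le_norm_twoSlot {i₁ i₂ : n} (hne : i₁ ≠ i₂) (a b : ℝ) :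
    |b| ≤ ‖(diagonal (Pi.single i₁ (((a : ℂ)) * Complex.I) + Pi.single i₂ (((b : ℂ)) * Complex.I)) : Matrix n n ℂ)‖ := by
  rw [l2_opNorm_diagonal]
  have h := norm_le_pi_norm (Pi.single i₁ (((a : ℂ)) * Complex.I) + Pi.single i₂ (((b : ℂ)) * Complex.I) : n → ℂ) i₂
  rwa [Pi.add_apply, Pi.single_eq_of_ne (Ne.symm hne), Pi.single_eq_same, zero_add, norm_real_mul_I] at h

/-- `e^{A + B + (−C)} = e^{A}·e^{B}·e^{−C}` for pairwise commuting matrices. [folklore] -/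
theorem exp_add_add_neg_of_commute {A B C : Matrix n n ℂ} (hAB : Commute A B) (hAC : Commute A C) (hBC : Commute B C) :
    exp (A + B + -C) = exp A * exp B * exp (-C) := by
  letI : NormedAlgebra ℚ (Matrix n n ℂ) := NormedAlgebra.restrictScalars ℚ ℝ (Matrix n n ℂ)
  have h1 : Commute (A + B) (-C) := (hAC.neg_right).add_left hBC.neg_right
  rw [NormedSpace.exp_add_of_commute h1, NormedSpace.exp_add_of_commute hAB]

omit [Fintype n] in
/-- The field of §2 is the diagonal of `a + b − c` with `a, b, c` the three single-slot vectors. [folklore] -/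
theorem diagonal_twoSlot_eq (i₁ i₂ : n) (ta tb r : ℝ) :
    (diagonal (Pi.single i₁ ((((ta - tb : ℝ)) : ℂ) * Complex.I) + Pi.single i₂ (((r : ℂ)) * Complex.I)) : Matrix n n ℂ)
      = diagonal (Pi.single i₁ (((ta : ℂ)) * Complex.I)) + diagonal (Pi.single i₂ (((r : ℂ)) * Complex.I))
        + -diagonal (Pi.single i₁ (((tb : ℂ)) * Complex.I)) := by
  rw [diagonal_neg, diagonal_add, diagonal_add]
  congr 1
  funext j
  simp only [Pi.add_apply, Pi.single_apply]
  split_ifs <;> push_cast <;> ring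


/-- **DIAGONAL GAUGE DATA**: two slots `i₁ ≠ i₂`, a real potential `t` with `0 ≤ t ≤ Λ₀ ≤ 1∕8192`, `N·L^k`-periodic and dominated on each box of record by
`Λ(z,κ)·Σ_{c∈S(z,κ)} prof(y − c)`, and a bulk size `0 ≤ r ≤ 1∕8192`.  Then the charges `λ(y) = t(y)·i·E_{i₁i₁}`, the companion `B ≡ r·i·E_{i₂i₂}` and the field
`X₀(y,μ) = diag((t(y) − t(y+e_μ))·i·δ_{i₁} + r·i·δ_{i₂})` satisfy (Π-REG-γ″) at `W = flatCfg` with tiers `m ≡ r`, `ℓ ≡ 0`, the given `Λ`, and ANY `C ≥ 0` such that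
`(L^k)^d·Σ_{z,κ}(r² + (Λ z κ∕L^k)²) ≤ C²·(N·L^k)^d·d·r²` — because the bulk slot keeps `‖X₀(y,μ)‖ ≥ r` on every bond. [folklore] -/
theorem gaugedTwoTier_of_diagonalGauge {i₁ i₂ : n} (hne : i₁ ≠ i₂) {L : ℕ} (N k : ℕ) {prof : Site d → ℝ}
    {S : Site d → Fin d → Finset (Site d)} (hS : ∀ z κ, (S z κ).card ≤ 3 * 2 ^ d)
    {t : Site d → ℝ} {Λ₀ r : ℝ} (ht0 : ∀ y, 0 ≤ t y) (ht1 : ∀ y, t y ≤ Λ₀) (hΛ₀ : Λ₀ ≤ 1 / 8192)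
    (htP : ∀ (y : Site d) (i : Fin d), t (y + ((L ^ k * N : ℕ) : ℤ) • e i) = t y)
    {Λ : Site d → Fin d → ℝ} (hΛ0 : ∀ z κ, 0 ≤ Λ z κ)
    (htdom : ∀ (z : Site d) (κ : Fin d) (y : Site d), InBox (loK L k z) (bondHiK L k z κ) y → t y ≤ Λ z κ * ∑ c ∈ S z κ, prof (y - c))
    (hr0 : 0 ≤ r) (hr : r ≤ 1 / 8192) {C : ℝ} (hC : 0 ≤ C)
    (hmass : ((L : ℝ) ^ k) ^ d * ∑ z ∈ periodBox (d := d) N, ∑ κ : Fin d, (r ^ 2 + (0 : ℝ) ^ 2 + (Λ z κ / (L : ℝ) ^ k) ^ 2)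
      ≤ C ^ 2 * ((((N * L ^ k) ^ d : ℕ) : ℝ) * ((d : ℝ) * r ^ 2))) :
    GaugedTwoTier L N k (flatCfg (d := d) (n := n))
      (fun (y : Site d) (μ : Fin d) => diagonal (Pi.single i₁ ((((t y - t (y + e μ) : ℝ)) : ℂ) * Complex.I) + Pi.single i₂ (((r : ℂ)) * Complex.I)))
      prof S (fun _ _ => r) (fun _ _ => 0) Λ C := by
  letI : NormedAlgebra ℚ (Matrix n n ℂ) := NormedAlgebra.restrictScalars ℚ ℝ (Matrix n n ℂ)
  refine ⟨fun _ _ => hr0, fun _ _ => le_rfl, hΛ0, hS, hC,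
    ⟨fun y => diagonal (Pi.single i₁ (((t y : ℝ) : ℂ) * Complex.I)), fun _ _ => diagonal (Pi.single i₂ (((r : ℂ)) * Complex.I)), ?_⟩, ?_⟩
  · -- the gauge data
    exact
      { lam_skew := fun y => diagonal_mem_skewAdjoint (star_single_ofReal_mul_I i₁ (t y))
        lam_per := fun y i => by simp only [htP]
        lam_small := fun y => by
          rw [norm_diagonal_single, abs_of_nonneg (ht0 y)]; exact (ht1 y).trans hΛ₀
        B_skew := fun _ _ => diagonal_mem_skewAdjoint (star_single_ofReal_mul_I i₂ r)
        B_per := fun _ _ _ => rfl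
        B_small := fun _ _ => by rw [norm_diagonal_single, abs_of_nonneg hr0]; exact hr
        gauge_eq := by
          funext y μ
          apply Units.ext
          simp only [vary, gaugeAct, expGauge, flatCfg, Units.val_mul, val_expUnit, val_inv_expUnit, one_mul, one_smul,
            Complex.ofReal_one]
          -- `exp(X₀) = exp(λ y) · exp(B) · exp(−λ(y+e μ))` for commuting diagonal data
          rw [diagonal_twoSlot_eq, exp_add_add_neg_of_commute (commute_diagonal _ _) (commute_diagonal _ _) (commute_diagonal _ _)]
        dom_B := fun _ _ y μ _ _ => by rw [norm_diagonal_single, abs_of_nonneg hr0]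
        dom_lam := fun z κ y hy => by
          rw [norm_diagonal_single, abs_of_nonneg (ht0 y), zero_add]; exact htdom z κ y hy }
  · -- (T3): the bulk slot carries the ℓ² mass
    refine hmass.trans (mul_le_mul_of_nonneg_left ?_ (sq_nonneg C))
    unfold dirSq
    rw [← card_periodBox (d := d) (N * L ^ k)]
    have e1 : ∑ _y ∈ periodBox (d := d) (N * L ^ k), ∑ _μ : Fin d, r ^ 2 = ((periodBox (d := d) (N * L ^ k)).card : ℝ) * ((d : ℝ) * r ^ 2) := by
      simp only [Finset.sum_const, Finset.card_univ, Fintype.card_fin, nsmul_eq_mul]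
      try ring
    rw [← e1]
    refine Finset.sum_le_sum fun y _ => Finset.sum_le_sum fun μ _ => pow_le_pow_left₀ hr0 ?_ 2
    have h := abs_le_norm_twoSlot hne (t y - t (y + e μ)) r
    rwa [abs_of_nonneg hr0] at h

/-- **THE CORNER-SPIKE WITNESS.**  Any dimension, two distinct diagonal slots `i₁ ≠ i₂`, `L ≥ 1`, ANY profile `0 ≤ prof ≤ 1`, bulk size `r` and spike ratio
`σ ≥ 0` with `r ≤ 1∕8192`, `σ·L^k·r ≤ 1∕8192`.  The potential `t(y) := σ·L^k·r·prof(y − ⌊y∕L^k⌋L^k)` (the profile re-rooted at the lower corner of each block,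
hence `N·L^k`-periodic for every `prof`) gives, through `gaugedTwoTier_of_diagonalGauge`, (Π-REG-γ″) at `W = flatCfg` with tiers `m ≡ r`, `ℓ ≡ 0`, spike amplitude
`Λ ≡ σ·L^k·r`, corner sets `S z κ = {L^k•z, L^k•(z+e_κ)}` and the **k-FREE constant `C = 1 + σ`** — although for the corner-indicator profile the field
`X₀` has spikes of height `σ·L^k·r` on the `2d` bonds at every block corner, i.e. relative height `σ·L^k` over its bulk (the configuration for which the
retired sup-currency shape needed `(L^k)^d ≤ C²`, `NE3LocalSupMajorantWitness.sq_le_of_oneBond`). [folklore] -/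
theorem gaugedTwoTier_cornerSpike {i₁ i₂ : n} (hne : i₁ ≠ i₂) {L : ℕ} (hL : 1 ≤ L) (N k : ℕ) {prof : Site d → ℝ}
    (hp0 : ∀ v, 0 ≤ prof v) (hp1 : ∀ v, prof v ≤ 1) {r σ : ℝ} (hr0 : 0 ≤ r) (hσ0 : 0 ≤ σ) (hr : r ≤ 1 / 8192)
    (hΛ : σ * (L : ℝ) ^ k * r ≤ 1 / 8192) :
    GaugedTwoTier L N k (flatCfg (d := d) (n := n))
      (fun (y : Site d) (μ : Fin d) => diagonal
        (Pi.single i₁ ((((σ * (L : ℝ) ^ k * r * prof (y - fun j => ((L : ℤ) ^ k) * (y j / (L : ℤ) ^ k))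
            - σ * (L : ℝ) ^ k * r * prof ((y + e μ) - fun j => ((L : ℤ) ^ k) * ((y + e μ) j / (L : ℤ) ^ k)) : ℝ) : ℂ)) * Complex.I)
          + Pi.single i₂ (((r : ℂ)) * Complex.I)))
      prof (fun z κ => ({loK L k z, loK L k (z + e κ)} : Finset (Site d)))
      (fun _ _ => r) (fun _ _ => 0) (fun _ _ => σ * (L : ℝ) ^ k * r) (1 + σ) := by
  have hM0 : ((L : ℤ) ^ k) ≠ 0 := by positivity
  have hLk : (0 : ℝ) < (L : ℝ) ^ k := by positivity
  refine gaugedTwoTier_of_diagonalGauge hne N k (t := fun y => σ * (L : ℝ) ^ k * r * prof (y - fun j => ((L : ℤ) ^ k) * (y j / (L : ℤ) ^ k)))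
    (fun z κ => ?_) (fun y => mul_nonneg (by positivity) (hp0 _)) (fun y => mul_le_of_le_one_right (by positivity) (hp1 _)) hΛ
    (fun y i => ?_) (fun _ _ => by positivity) (fun z κ y hy => ?_) hr0 hr (by positivity) ?_
  · -- two corner points
    calc ({loK L k z, loK L k (z + e κ)} : Finset (Site d)).card ≤ 2 := Finset.card_le_two
      _ ≤ 3 * 2 ^ d := by have : 1 ≤ 2 ^ d := Nat.one_le_two_pow; omega
  · -- periodicity of the re-rooted profile
    congr 2
    have hP : ((L ^ k * N : ℕ) : ℤ) = (L : ℤ) ^ k * (N : ℤ) := by push_cast; ring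
    rw [hP, blockCorner_periodic ((L : ℤ) ^ k) hM0 (N : ℤ) y i]
    abel
  · -- domination by the corner sum: the block corner of `y` is one of the two corners of the box
    have hmem := blockCorner_mem_pair hL k z κ hy
    have hle : prof (y - fun j => ((L : ℤ) ^ k) * (y j / (L : ℤ) ^ k)) ≤ ∑ c ∈ ({loK L k z, loK L k (z + e κ)} : Finset (Site d)), prof (y - c) :=
      Finset.single_le_sum (f := fun c => prof (y - c)) (fun c _ => hp0 _) hmem
    exact mul_le_mul_of_nonneg_left hle (by positivity)
  · -- the mass line: `(L^k)^d·N^d·d·(r² + (σr)²) ≤ (1+σ)²·(N·L^k)^d·d·r²`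
    have e1 : ∑ z ∈ periodBox (d := d) N, ∑ κ : Fin d, (r ^ 2 + (0 : ℝ) ^ 2 + (σ * (L : ℝ) ^ k * r / (L : ℝ) ^ k) ^ 2)
        = ((N : ℝ) ^ d * (d : ℝ)) * ((1 + σ ^ 2) * r ^ 2) := by
      have hc : σ * (L : ℝ) ^ k * r / (L : ℝ) ^ k = σ * r := by field_simp
      simp only [hc, Finset.sum_const, Finset.card_univ, Fintype.card_fin, nsmul_eq_mul, card_periodBox]
      push_cast; ring
    rw [e1]
    have hσ : 1 + σ ^ 2 ≤ (1 + σ) ^ 2 := by nlinarith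
    have hbase : 0 ≤ ((L : ℝ) ^ k) ^ d * ((N : ℝ) ^ d * (d : ℝ)) * r ^ 2 := by positivity
    calc ((L : ℝ) ^ k) ^ d * (((N : ℝ) ^ d * (d : ℝ)) * ((1 + σ ^ 2) * r ^ 2))
        = (1 + σ ^ 2) * (((L : ℝ) ^ k) ^ d * ((N : ℝ) ^ d * (d : ℝ)) * r ^ 2) := by ring
      _ ≤ (1 + σ) ^ 2 * (((L : ℝ) ^ k) ^ d * ((N : ℝ) ^ d * (d : ℝ)) * r ^ 2) := mul_le_mul_of_nonneg_right hσ hbase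
      _ = (1 + σ) ^ 2 * ((((N * L ^ k) ^ d : ℕ) : ℝ) * ((d : ℝ) * r ^ 2)) := by push_cast; ring

end spike

end

end Summit.QuantumFields.BalabanUV.T4Continuum.NE3GaugedTwoTierWitness
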